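import Summits.CriticalPhenomena.PercolationContinuityZ3.Theorems.PercNearOneGluingNoHeavyLowerTailSahiOneStepGoodPivotReduction
import HarnessLib

/-!
# One-step scheme: the pivot certificate WITH THE CUBIC SLACK (support file for the WINDOW step)

Prover prim-ineq-prove-3 gen 39 (`--supports stmt-CriticalPhenomena-4575`; memo
`run/shared/lean/prim/prim-ineq-prove-3/FINDING-G39-WINDOW.md` §1–2).  No definitions, no sorries.

Setting of the one-coordinate step (gen 19/27): `e ∉ F`, slot `{N_{insert e F} ≥ t+1}`, increasing `A, B` (arbitrary), sections
`A¹ ⊇ A⁰`, `B¹ ⊇ B⁰` at `e`, `L¹ = {N_F < t}`, `S = {N_F = t}`, `L⁰ = {N_F < t+1}`, `ℓ¹ = μ L¹`, `σ = μ S`, `ℓ⁰ = ℓ¹ + σ`, `b^y = μ B^y`,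
`q = 1 − p_e`.  Gen 27 (`osN_threshold_step_of_pivotCertificate`) certified the `p_e`-free step form `M₂`; but the degree-3 expansion
of `n` in `p_e` (`osN_ind_ind_pivot_eq`) reads `n = p²·n¹ + q²·n⁰ + pq·(M₂ + q·(μH¹−μH⁰)(μA¹−μA⁰)(μB¹−μB⁰))`, and for the threshold
slot the cubic term `q·σ·ΔA·ΔB ≥ 0` is a SLACK of `q·σ·(b¹−b⁰)` on each of the three `E_A`-coefficients `e_I, e_II, e_III` of the
gen-27 certificate.  This file records
* `osN_ind_ind_nonneg_of_step'` — the inductive step with the weaker hypothesis `0 ≤ M₂ + q·(μH¹−μH⁰)(μA¹−μA⁰)(μB¹−μB⁰)`;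
* `pivotCertificate_slack_identity` — the polynomial identity (pure `ring`);
* `osN_threshold_step_of_pivotCertificate'` — the certificate step with the three coefficient conditions relaxed by the slack.
The companion file `…SahiOneStepWindow` turns this into the WINDOW STEP (`X̃_B ≥ 0` and `Ψ_B ≥ −qσ(b¹−b⁰)μ(L⁰∖B⁰)` suffice) —
exactly the feasibility region of the gen-38 piece-level certificate LP — and the reduction of `(2′)` for all pairs to the
window-pivot property.
-/

noncomputable section

namespace Summit.CriticalPhenomena.PercolationContinuityZ3.Theorems

namespace SahiOneStep

open MeasureTheory Finset
open Literature.Probability.Percolation (DeterminedBy determinedBy_iff determinedBy_univ)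
open Literature.Probability.LatticeModels (prodBernoulli sahiE3 prodBernoulli_harris)
open Literature.Probability.Percolation.DecisionTree (ind)
open scoped Classical

variable {ι : Type*} [Fintype ι]

/-! ## The inductive step with the cubic slack -/

-- gen 40: heartbeat margin (the `nlinarith` step below needs > 60k of the default 200k heartbeats).
set_option maxHeartbeats 400000 in
/-- **The inductive step for `(2′)` with the cubic slack**: if `n ≥ 0` for both section triples at `e`, the sections are monotone and
`0 ≤ M₂ + (1 − p_e)·(μH¹−μH⁰)(μA¹−μA⁰)(μB¹−μB⁰)`, then `n(H;A,B) ≥ 0` (since `p·M₂ + q·M₁ = M₂ + q·(M₁ − M₂)`). [this work] -/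
theorem osN_ind_ind_nonneg_of_step' (p : ι → unitInterval) (H A B : Set (Set ι)) (e : ι)
    (h1 : 0 ≤ osN p {ω : Set ι | insert e ω ∈ H} (ind {ω : Set ι | insert e ω ∈ A}) (ind {ω : Set ι | insert e ω ∈ B}))
    (h0 : 0 ≤ osN p {ω : Set ι | ω \ {e} ∈ H} (ind {ω : Set ι | ω \ {e} ∈ A}) (ind {ω : Set ι | ω \ {e} ∈ B}))
    (hM : 0 ≤
      ((prodBernoulli p).real {ω : Set ι | ω \ {e} ∈ A} - (prodBernoulli p).real ({ω : Set ι | ω \ {e} ∈ H} ∩ {ω : Set ι | ω \ {e} ∈ A})) *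
          ((prodBernoulli p).real {ω : Set ι | insert e ω ∈ B} - (prodBernoulli p).real ({ω : Set ι | insert e ω ∈ H} ∩ {ω : Set ι | insert e ω ∈ B}))
        + ((prodBernoulli p).real {ω : Set ι | insert e ω ∈ A} - (prodBernoulli p).real ({ω : Set ι | insert e ω ∈ H} ∩ {ω : Set ι | insert e ω ∈ A})) *
          ((prodBernoulli p).real {ω : Set ι | ω \ {e} ∈ B} - (prodBernoulli p).real ({ω : Set ι | ω \ {e} ∈ H} ∩ {ω : Set ι | ω \ {e} ∈ B}))
        + (1 - (prodBernoulli p).real {ω : Set ι | ω \ {e} ∈ H}) *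
          (prodBernoulli p).real ({ω : Set ι | insert e ω ∈ H} ∩ {ω : Set ι | insert e ω ∈ A} ∩ {ω : Set ι | insert e ω ∈ B})
        + (1 - (prodBernoulli p).real {ω : Set ι | insert e ω ∈ H}) *
          (prodBernoulli p).real ({ω : Set ι | ω \ {e} ∈ H} ∩ {ω : Set ι | ω \ {e} ∈ A} ∩ {ω : Set ι | ω \ {e} ∈ B})
        - ((prodBernoulli p).real {ω : Set ι | insert e ω ∈ H} - (prodBernoulli p).real {ω : Set ι | ω \ {e} ∈ H}) *
          (prodBernoulli p).real {ω : Set ι | insert e ω ∈ A} * (prodBernoulli p).real {ω : Set ι | insert e ω ∈ B}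
        - (1 - (prodBernoulli p).real {ω : Set ι | insert e ω ∈ H}) *
          ((prodBernoulli p).real {ω : Set ι | insert e ω ∈ A} * (prodBernoulli p).real {ω : Set ι | ω \ {e} ∈ B}
            + (prodBernoulli p).real {ω : Set ι | ω \ {e} ∈ A} * (prodBernoulli p).real {ω : Set ι | insert e ω ∈ B})
        + (1 - p e) * (((prodBernoulli p).real {ω : Set ι | insert e ω ∈ H} - (prodBernoulli p).real {ω : Set ι | ω \ {e} ∈ H}) *
          ((prodBernoulli p).real {ω : Set ι | insert e ω ∈ A} - (prodBernoulli p).real {ω : Set ι | ω \ {e} ∈ A}) *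
          ((prodBernoulli p).real {ω : Set ι | insert e ω ∈ B} - (prodBernoulli p).real {ω : Set ι | ω \ {e} ∈ B})))
    (hH : (prodBernoulli p).real {ω : Set ι | ω \ {e} ∈ H} ≤ (prodBernoulli p).real {ω : Set ι | insert e ω ∈ H})
    (hA : (prodBernoulli p).real {ω : Set ι | ω \ {e} ∈ A} ≤ (prodBernoulli p).real {ω : Set ι | insert e ω ∈ A})
    (hB : (prodBernoulli p).real {ω : Set ι | ω \ {e} ∈ B} ≤ (prodBernoulli p).real {ω : Set ι | insert e ω ∈ B}) :
    0 ≤ osN p H (ind A) (ind B) := by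
  rw [osN_ind_ind_pivot_eq p H A B e]
  have hp0 : 0 ≤ (p e : ℝ) := (p e).2.1
  have hq0 : 0 ≤ 1 - (p e : ℝ) := sub_nonneg.2 (p e).2.2
  have hX : 0 ≤ ((prodBernoulli p).real {ω : Set ι | insert e ω ∈ H} - (prodBernoulli p).real {ω : Set ι | ω \ {e} ∈ H}) *
      ((prodBernoulli p).real {ω : Set ι | insert e ω ∈ A} - (prodBernoulli p).real {ω : Set ι | ω \ {e} ∈ A}) *
      ((prodBernoulli p).real {ω : Set ι | insert e ω ∈ B} - (prodBernoulli p).real {ω : Set ι | ω \ {e} ∈ B}) :=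
    mul_nonneg (mul_nonneg (sub_nonneg.2 hH) (sub_nonneg.2 hA)) (sub_nonneg.2 hB)
  set M2 : ℝ :=
      ((prodBernoulli p).real {ω : Set ι | ω \ {e} ∈ A} - (prodBernoulli p).real ({ω : Set ι | ω \ {e} ∈ H} ∩ {ω : Set ι | ω \ {e} ∈ A})) *
          ((prodBernoulli p).real {ω : Set ι | insert e ω ∈ B} - (prodBernoulli p).real ({ω : Set ι | insert e ω ∈ H} ∩ {ω : Set ι | insert e ω ∈ B}))
        + ((prodBernoulli p).real {ω : Set ι | insert e ω ∈ A} - (prodBernoulli p).real ({ω : Set ι | insert e ω ∈ H} ∩ {ω : Set ι | insert e ω ∈ A})) *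
          ((prodBernoulli p).real {ω : Set ι | ω \ {e} ∈ B} - (prodBernoulli p).real ({ω : Set ι | ω \ {e} ∈ H} ∩ {ω : Set ι | ω \ {e} ∈ B}))
        + (1 - (prodBernoulli p).real {ω : Set ι | ω \ {e} ∈ H}) *
          (prodBernoulli p).real ({ω : Set ι | insert e ω ∈ H} ∩ {ω : Set ι | insert e ω ∈ A} ∩ {ω : Set ι | insert e ω ∈ B})
        + (1 - (prodBernoulli p).real {ω : Set ι | insert e ω ∈ H}) *
          (prodBernoulli p).real ({ω : Set ι | ω \ {e} ∈ H} ∩ {ω : Set ι | ω \ {e} ∈ A} ∩ {ω : Set ι | ω \ {e} ∈ B})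
        - ((prodBernoulli p).real {ω : Set ι | insert e ω ∈ H} - (prodBernoulli p).real {ω : Set ι | ω \ {e} ∈ H}) *
          (prodBernoulli p).real {ω : Set ι | insert e ω ∈ A} * (prodBernoulli p).real {ω : Set ι | insert e ω ∈ B}
        - (1 - (prodBernoulli p).real {ω : Set ι | insert e ω ∈ H}) *
          ((prodBernoulli p).real {ω : Set ι | insert e ω ∈ A} * (prodBernoulli p).real {ω : Set ι | ω \ {e} ∈ B}
            + (prodBernoulli p).real {ω : Set ι | ω \ {e} ∈ A} * (prodBernoulli p).real {ω : Set ι | insert e ω ∈ B}) with hM2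
  set X : ℝ := ((prodBernoulli p).real {ω : Set ι | insert e ω ∈ H} - (prodBernoulli p).real {ω : Set ι | ω \ {e} ∈ H}) *
      ((prodBernoulli p).real {ω : Set ι | insert e ω ∈ A} - (prodBernoulli p).real {ω : Set ι | ω \ {e} ∈ A}) *
      ((prodBernoulli p).real {ω : Set ι | insert e ω ∈ B} - (prodBernoulli p).real {ω : Set ι | ω \ {e} ∈ B}) with hXd
  change 0 ≤ M2 + (1 - p e) * X at hM
  have t1 := mul_nonneg (pow_nonneg hp0 2) h1
  have t2 := mul_nonneg (pow_nonneg hq0 2) h0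
  -- `p·M₂ + q·(M₂ + X) = (M₂ + q X) + 0`, times `pq ≥ 0`
  have hid : (p e : ℝ) * M2 + (1 - p e) * (M2 + X) = M2 + (1 - p e) * X := by ring
  have t5 : 0 ≤ (p e : ℝ) * (1 - p e) * ((p e : ℝ) * M2 + (1 - p e) * (M2 + X)) := by
    rw [hid]; exact mul_nonneg (mul_nonneg hp0 hq0) hM
  nlinarith [t1, t2, t5]

/-! ## The pivot step from an explicit certificate, with the cubic slack -/

/-- The polynomial identity behind `osN_threshold_step_of_pivotCertificate'` (pure commutative-ring bookkeeping in the piece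
variables; separated out to keep the elaboration of the main step cheap). [this work] -/
theorem pivotCertificate_slack_identity (l1 σ r q aL aS aH a0L a0S a0H bL bS bH b0L b0S b0H cS cH c10 c00 : ℝ) :
    l1 * (l1 + σ) *
      ((a0H + (a0L + a0S) - a0H) * (bH + (bL + bS) - (bS + bH)) + (aH + (aL + aS) - (aS + aH)) * (b0H + (b0L + b0S) - b0H)
        + (1 - (1 - l1 - σ)) * (cS + cH) + (1 - (1 - l1)) * c00
        - ((1 - l1) - (1 - l1 - σ)) * (aH + (aL + aS)) * (bH + (bL + bS))
        - (1 - (1 - l1)) * ((aH + (aL + aS)) * (b0H + (b0L + b0S)) + (a0H + (a0L + a0S)) * (bH + (bL + bS)))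
        + q * (((1 - l1) - (1 - l1 - σ)) * ((aH + (aL + aS)) - (a0H + (a0L + a0S))) * ((bH + (bL + bS)) - (b0H + (b0L + b0S)))))
      = (l1 + σ) * (l1 + σ) * ((aS + aH) * (bS + bH) + (1 - (1 - l1)) * (cS + cH) + (1 - l1) * (aH + (aL + aS)) * (bH + (bL + bS))
            - (aS + aH) * (bH + (bL + bS)) - (bS + bH) * (aH + (aL + aS)))
        + l1 * (l1 - r * (l1 + σ)) * (aH * b0H + (1 - (1 - l1 - σ)) * c10 + (1 - l1 - σ) * (aH + (aL + aS)) * (b0H + (b0L + b0S))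
            - aH * (b0H + (b0L + b0S)) - b0H * (aH + (aL + aS)))
        + l1 * (l1 + σ) * r * (a0H * b0H + (1 - (1 - l1 - σ)) * c00 + (1 - l1 - σ) * (a0H + (a0L + a0S)) * (b0H + (b0L + b0S))
            - a0H * (b0H + (b0L + b0S)) - b0H * (a0H + (a0L + a0S)))
        + ((l1 + σ) * bL - l1 * (b0L + b0S)) * (aS * l1 - aL * σ)
        + l1 * (l1 + σ) * (((l1 * (bH + (bL + bS)) - bL) - r * ((l1 + σ) * (b0H + (b0L + b0S)) - (b0L + b0S))
              + q * σ * ((bH + (bL + bS)) - (b0H + (b0L + b0S)))) * ((aL + aS) - (a0L + a0S))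
            + (l1 * (bH + (bL + bS)) - r * ((l1 + σ) * (b0H + (b0L + b0S)))
              + q * σ * ((bH + (bL + bS)) - (b0H + (b0L + b0S)))) * ((aH - c10) - (a0H - c00))
            + (r * ((l1 + σ) * (1 - (b0H + (b0L + b0S)))) - l1 * (1 - (bH + (bL + bS)))
              + q * σ * ((bH + (bL + bS)) - (b0H + (b0L + b0S)))) * (c10 - c00)) := by
  ring

/-- **THE PIVOT STEP WITH AN EXPLICIT CERTIFICATE, SLACK FORM.**  As `osN_threshold_step_of_pivotCertificate`, but each of the three
certificate-coefficient conditions `e_I, e_II, e_III ≥ 0` is relaxed by the cubic slack `(1 − p_e)·σ·(b¹ − b⁰)`, `σ = μ{N_F = t}`: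
`e_I + qσ(b¹−b⁰) ≥ 0`, `e_II + qσ(b¹−b⁰) ≥ 0`, `e_III + qσ(b¹−b⁰) ≥ 0`. [this work] -/
theorem osN_threshold_step_of_pivotCertificate' (p : ι → unitInterval) {F : Finset ι} {e : ι} (he : e ∉ F) (t : ℕ)
    {A B : Set (Set ι)} (hA : IsUpperSet A) (hB : IsUpperSet B) (r : ℝ) (hr0 : 0 ≤ r)
    (hr1 : r * (prodBernoulli p).real {ω : Set ι | (F.filter (· ∈ ω)).card < t + 1} ≤
      (prodBernoulli p).real {ω : Set ι | (F.filter (· ∈ ω)).card < t})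
    (h11 : 0 ≤ osN p {ω : Set ι | t ≤ (F.filter (· ∈ ω)).card} (ind {ω : Set ι | insert e ω ∈ A}) (ind {ω : Set ι | insert e ω ∈ B}))
    (h10 : 0 ≤ osN p {ω : Set ι | t + 1 ≤ (F.filter (· ∈ ω)).card} (ind {ω : Set ι | insert e ω ∈ A}) (ind {ω : Set ι | ω \ {e} ∈ B}))
    (h00 : 0 ≤ osN p {ω : Set ι | t + 1 ≤ (F.filter (· ∈ ω)).card} (ind {ω : Set ι | ω \ {e} ∈ A}) (ind {ω : Set ι | ω \ {e} ∈ B}))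
    (hX : (prodBernoulli p).real {ω : Set ι | (F.filter (· ∈ ω)).card < t} *
        (prodBernoulli p).real ({ω : Set ι | ω \ {e} ∈ B} ∩ {ω : Set ι | (F.filter (· ∈ ω)).card < t + 1}) ≤
      (prodBernoulli p).real {ω : Set ι | (F.filter (· ∈ ω)).card < t + 1} *
        (prodBernoulli p).real ({ω : Set ι | insert e ω ∈ B} ∩ {ω : Set ι | (F.filter (· ∈ ω)).card < t}))
    (heI : r * ((prodBernoulli p).real {ω : Set ι | (F.filter (· ∈ ω)).card < t + 1} * (prodBernoulli p).real {ω : Set ι | ω \ {e} ∈ B}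
          - (prodBernoulli p).real ({ω : Set ι | ω \ {e} ∈ B} ∩ {ω : Set ι | (F.filter (· ∈ ω)).card < t + 1})) ≤
        (prodBernoulli p).real {ω : Set ι | (F.filter (· ∈ ω)).card < t} * (prodBernoulli p).real {ω : Set ι | insert e ω ∈ B}
          - (prodBernoulli p).real ({ω : Set ι | insert e ω ∈ B} ∩ {ω : Set ι | (F.filter (· ∈ ω)).card < t})
        + (1 - p e) * (prodBernoulli p).real {ω : Set ι | (F.filter (· ∈ ω)).card = t} *
          ((prodBernoulli p).real {ω : Set ι | insert e ω ∈ B} - (prodBernoulli p).real {ω : Set ι | ω \ {e} ∈ B}))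
    (heII : r * ((prodBernoulli p).real {ω : Set ι | (F.filter (· ∈ ω)).card < t + 1} * (prodBernoulli p).real {ω : Set ι | ω \ {e} ∈ B}) ≤
        (prodBernoulli p).real {ω : Set ι | (F.filter (· ∈ ω)).card < t} * (prodBernoulli p).real {ω : Set ι | insert e ω ∈ B}
        + (1 - p e) * (prodBernoulli p).real {ω : Set ι | (F.filter (· ∈ ω)).card = t} *
          ((prodBernoulli p).real {ω : Set ι | insert e ω ∈ B} - (prodBernoulli p).real {ω : Set ι | ω \ {e} ∈ B}))
    (heIII : (prodBernoulli p).real {ω : Set ι | (F.filter (· ∈ ω)).card < t} * (1 - (prodBernoulli p).real {ω : Set ι | insert e ω ∈ B}) ≤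
        r * ((prodBernoulli p).real {ω : Set ι | (F.filter (· ∈ ω)).card < t + 1} * (1 - (prodBernoulli p).real {ω : Set ι | ω \ {e} ∈ B}))
        + (1 - p e) * (prodBernoulli p).real {ω : Set ι | (F.filter (· ∈ ω)).card = t} *
          ((prodBernoulli p).real {ω : Set ι | insert e ω ∈ B} - (prodBernoulli p).real {ω : Set ι | ω \ {e} ∈ B})) :
    0 ≤ osN p {ω : Set ι | t + 1 ≤ ((insert e F).filter (· ∈ ω)).card} (ind A) (ind B) := by
  set μ := prodBernoulli p with hμ
  set H1 : Set (Set ι) := {ω : Set ι | t ≤ (F.filter (· ∈ ω)).card} with hH1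
  set H0 : Set (Set ι) := {ω : Set ι | t + 1 ≤ (F.filter (· ∈ ω)).card} with hH0
  set L1 : Set (Set ι) := {ω : Set ι | (F.filter (· ∈ ω)).card < t} with hL1
  set L0 : Set (Set ι) := {ω : Set ι | (F.filter (· ∈ ω)).card < t + 1} with hL0
  set S : Set (Set ι) := {ω : Set ι | (F.filter (· ∈ ω)).card = t} with hS
  set A1 : Set (Set ι) := {ω : Set ι | insert e ω ∈ A} with hA1
  set A0 : Set (Set ι) := {ω : Set ι | ω \ {e} ∈ A} with hA0
  set B1 : Set (Set ι) := {ω : Set ι | insert e ω ∈ B} with hB1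
  set B0 : Set (Set ι) := {ω : Set ι | ω \ {e} ∈ B} with hB0
  have sH1 : {ω : Set ι | insert e ω ∈ {ω : Set ι | t + 1 ≤ ((insert e F).filter (· ∈ ω)).card}} = H1 := section_insert_threshold he t
  have sH0 : {ω : Set ι | ω \ {e} ∈ {ω : Set ι | t + 1 ≤ ((insert e F).filter (· ∈ ω)).card}} = H0 := section_sdiff_threshold he t
  have hA1u : IsUpperSet A1 := isUpperSet_section_insert hA e
  have hB1u : IsUpperSet B1 := isUpperSet_section_insert hB e
  have hA01 : A0 ⊆ A1 := section_sdiff_subset_section_insert hA e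
  have hB01 : B0 ⊆ B1 := section_sdiff_subset_section_insert hB e
  have hH01 : H0 ⊆ H1 := fun ω hω => by simp only [hH0, hH1, Set.mem_setOf_eq] at hω ⊢; omega
  have hq0 : 0 ≤ 1 - (p e : ℝ) := sub_nonneg.2 (p e).2.2
  refine osN_ind_ind_nonneg_of_step' p {ω : Set ι | t + 1 ≤ ((insert e F).filter (· ∈ ω)).card} A B e
    ?_ ?_ ?_ ?_ ?_ ?_
  · rw [sH1]; exact h11
  · rw [sH0]; exact h00
  rotate_left
  · rw [sH1, sH0]; exact measureReal_mono hH01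
  · exact measureReal_mono hA01
  · exact measureReal_mono hB01
  rw [sH1, sH0]
  -- piece measures
  set l1 : ℝ := μ.real L1 with hl1
  set σ : ℝ := μ.real S with hσ
  set aL : ℝ := μ.real (A1 ∩ L1) with haL
  set aS : ℝ := μ.real (A1 ∩ S) with haS
  set aH : ℝ := μ.real (H0 ∩ A1) with haH
  set a0L : ℝ := μ.real (A0 ∩ L1) with ha0L
  set a0S : ℝ := μ.real (A0 ∩ S) with ha0S
  set a0H : ℝ := μ.real (H0 ∩ A0) with ha0H
  set bL : ℝ := μ.real (B1 ∩ L1) with hbL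
  set bS : ℝ := μ.real (B1 ∩ S) with hbS
  set bH : ℝ := μ.real (H0 ∩ B1) with hbH
  set b0L : ℝ := μ.real (B0 ∩ L1) with hb0L
  set b0S : ℝ := μ.real (B0 ∩ S) with hb0S
  set b0H : ℝ := μ.real (H0 ∩ B0) with hb0H
  set cL : ℝ := μ.real ((A1 ∩ B1) ∩ L1) with hcL
  set cS : ℝ := μ.real ((A1 ∩ B1) ∩ S) with hcS
  set cH : ℝ := μ.real (H0 ∩ (A1 ∩ B1)) with hcH
  set c10 : ℝ := μ.real (H0 ∩ A1 ∩ B0) with hc10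
  set c00 : ℝ := μ.real (H0 ∩ A0 ∩ B0) with hc00
  set q : ℝ := 1 - (p e : ℝ) with hq
  -- set identities used for the splits
  have cL0 : ∀ X : Set (Set ι), X \ H0 = X ∩ L0 := fun X => by
    ext ω; simp only [hH0, hL0, Set.mem_sdiff, Set.mem_inter_iff, Set.mem_setOf_eq, not_le]
  have cS' : ∀ X : Set (Set ι), (X ∩ L0) \ L1 = X ∩ S := fun X => by
    ext ω; simp only [hL0, hL1, hS, Set.mem_sdiff, Set.mem_inter_iff, Set.mem_setOf_eq, not_lt]; constructor
    · rintro ⟨⟨hX, h1⟩, h2⟩; exact ⟨hX, by omega⟩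
    · rintro ⟨hX, h⟩; exact ⟨⟨hX, by omega⟩, by omega⟩
  have cSL : ∀ X : Set (Set ι), (X ∩ L0) ∩ L1 = X ∩ L1 := fun X => by
    ext ω; simp only [hL0, hL1, Set.mem_inter_iff, Set.mem_setOf_eq]; constructor
    · rintro ⟨⟨hX, _⟩, h2⟩; exact ⟨hX, h2⟩
    · rintro ⟨hX, h⟩; exact ⟨⟨hX, by omega⟩, h⟩
  have cH1S : ∀ X : Set (Set ι), (H1 ∩ X) \ H0 = X ∩ S := fun X => by
    ext ω; simp only [hH1, hH0, hS, Set.mem_sdiff, Set.mem_inter_iff, Set.mem_setOf_eq, not_le]; constructor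
    · rintro ⟨⟨h1, hX⟩, h2⟩; exact ⟨hX, by omega⟩
    · rintro ⟨hX, h⟩; exact ⟨⟨by omega, hX⟩, by omega⟩
  have cH1H0 : ∀ X : Set (Set ι), (H1 ∩ X) ∩ H0 = H0 ∩ X := fun X => by
    ext ω; simp only [Set.mem_inter_iff]; constructor
    · rintro ⟨⟨_, hX⟩, h0⟩; exact ⟨h0, hX⟩
    · rintro ⟨h0, hX⟩; exact ⟨⟨hH01 h0, hX⟩, h0⟩
  -- splits: μ X = μ(H0 ∩ X) + μ(X ∩ L0), μ(X ∩ L0) = μ(X ∩ L1) + μ(X ∩ S), μ(H1 ∩ X) = μ(X ∩ S) + μ(H0 ∩ X)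
  have split0 : ∀ X : Set (Set ι), μ.real X = μ.real (H0 ∩ X) + μ.real (X ∩ L0) := fun X => by
    have h := measureReal_inter_add_sdiff (μ := μ) (s := X) (t := H0) MeasurableSet.of_discrete
    rw [cL0, Set.inter_comm X H0] at h; linarith
  have splitS : ∀ X : Set (Set ι), μ.real (X ∩ L0) = μ.real (X ∩ L1) + μ.real (X ∩ S) := fun X => by
    have h := measureReal_inter_add_sdiff (μ := μ) (s := X ∩ L0) (t := L1) MeasurableSet.of_discrete
    rw [cSL, cS'] at h; linarith
  have splitH1 : ∀ X : Set (Set ι), μ.real (H1 ∩ X) = μ.real (X ∩ S) + μ.real (H0 ∩ X) := fun X => by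
    have h := measureReal_inter_add_sdiff (μ := μ) (s := H1 ∩ X) (t := H0) MeasurableSet.of_discrete
    rw [cH1H0, cH1S] at h; linarith
  -- the named quantities
  have eA1 : μ.real A1 = aH + (aL + aS) := by rw [split0 A1, splitS A1]
  have eA0 : μ.real A0 = a0H + (a0L + a0S) := by rw [split0 A0, splitS A0]
  have eB1 : μ.real B1 = bH + (bL + bS) := by rw [split0 B1, splitS B1]
  have eB0 : μ.real B0 = b0H + (b0L + b0S) := by rw [split0 B0, splitS B0]
  have eH1A1 : μ.real (H1 ∩ A1) = aS + aH := splitH1 A1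
  have eH1B1 : μ.real (H1 ∩ B1) = bS + bH := splitH1 B1
  have eH1AB : μ.real (H1 ∩ A1 ∩ B1) = cS + cH := by rw [Set.inter_assoc]; exact splitH1 (A1 ∩ B1)
  have eAB : μ.real (A1 ∩ B1) = cH + (cL + cS) := by rw [split0 (A1 ∩ B1), splitS (A1 ∩ B1)]
  have eA1L0 : μ.real (A1 ∩ L0) = aL + aS := splitS A1
  have eA0L0 : μ.real (A0 ∩ L0) = a0L + a0S := splitS A0
  have eB0L0 : μ.real (B0 ∩ L0) = b0L + b0S := splitS B0
  have eL0 : μ.real L0 = l1 + σ := by have h := splitS Set.univ; simp only [Set.univ_inter] at h; exact h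
  have eH1 : μ.real H1 = 1 - l1 := by
    have h := splitH1 Set.univ; have h' := split0 Set.univ
    simp only [Set.inter_univ, Set.univ_inter, probReal_univ] at h h'; linarith
  have eH0 : μ.real H0 = 1 - l1 - σ := by
    have h' := split0 Set.univ; simp only [Set.inter_univ, Set.univ_inter, probReal_univ] at h'; linarith
  -- the three E-terms: E_A = A1 \ A0 restricted to L0, to H0 \ B0 and to H0 ∩ B0
  have hE1 : a0L + a0S ≤ aL + aS := by
    rw [← eA1L0, ← eA0L0]; exact measureReal_mono (Set.inter_subset_inter_left _ hA01)
  have eD1 : μ.real ((H0 ∩ A1) \ B0) = aH - c10 := by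
    have h := measureReal_inter_add_sdiff (μ := μ) (s := H0 ∩ A1) (t := B0) MeasurableSet.of_discrete; linarith
  have eD0 : μ.real ((H0 ∩ A0) \ B0) = a0H - c00 := by
    have h := measureReal_inter_add_sdiff (μ := μ) (s := H0 ∩ A0) (t := B0) MeasurableSet.of_discrete; linarith
  have hE2 : a0H - c00 ≤ aH - c10 := by
    rw [← eD1, ← eD0]
    exact measureReal_mono (Set.sdiff_subset_sdiff_left (Set.inter_subset_inter_right _ hA01))
  have hE3 : c00 ≤ c10 :=
    measureReal_mono (Set.inter_subset_inter_left _ (Set.inter_subset_inter_right _ hA01))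
  -- layer ≥ lower ball for `A1`
  have hUA : aL * σ ≤ aS * l1 := real_inter_ball_mul_layer_le' p F hA1u t
  -- monotone sections (for the degenerate branch)
  have hΔA : a0H + (a0L + a0S) ≤ aH + (aL + aS) := by
    rw [← eA1, ← eA0]; exact measureReal_mono hA01
  have hΔB : b0H + (b0L + b0S) ≤ bH + (bL + bS) := by
    rw [← eB1, ← eB0]; exact measureReal_mono hB01
  -- the three section hypotheses, unfolded
  have h11' := h11
  rw [osN_ind_ind] at h11'
  change 0 ≤ μ.real (H1 ∩ A1) * μ.real (H1 ∩ B1) + (1 - μ.real H1) * μ.real (H1 ∩ A1 ∩ B1) + μ.real H1 * μ.real A1 * μ.real B1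
      - μ.real (H1 ∩ A1) * μ.real B1 - μ.real (H1 ∩ B1) * μ.real A1 at h11'
  rw [eH1A1, eH1B1, eH1AB, eH1, eA1, eB1] at h11'
  have h10' := h10
  rw [osN_ind_ind] at h10'
  change 0 ≤ aH * b0H + (1 - μ.real H0) * c10 + μ.real H0 * μ.real A1 * μ.real B0 - aH * μ.real B0 - b0H * μ.real A1 at h10'
  rw [eH0, eA1, eB0] at h10'
  have h00' := h00
  rw [osN_ind_ind] at h00'
  change 0 ≤ a0H * b0H + (1 - μ.real H0) * c00 + μ.real H0 * μ.real A0 * μ.real B0 - a0H * μ.real B0 - b0H * μ.real A0 at h00'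
  rw [eH0, eA0, eB0] at h00'
  -- the certificate hypotheses in piece variables
  rw [eB0L0, eL0] at hX
  change l1 * (b0L + b0S) ≤ (l1 + σ) * bL at hX
  rw [eL0, eB0, eB0L0, eB1] at heI
  change r * ((l1 + σ) * (b0H + (b0L + b0S)) - (b0L + b0S)) ≤ l1 * (bH + (bL + bS)) - bL
    + q * σ * ((bH + (bL + bS)) - (b0H + (b0L + b0S))) at heI
  rw [eL0, eB0, eB1] at heII
  change r * ((l1 + σ) * (b0H + (b0L + b0S))) ≤ l1 * (bH + (bL + bS))
    + q * σ * ((bH + (bL + bS)) - (b0H + (b0L + b0S))) at heII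
  rw [eL0, eB0, eB1] at heIII
  change l1 * (1 - (bH + (bL + bS))) ≤ r * ((l1 + σ) * (1 - (b0H + (b0L + b0S))))
    + q * σ * ((bH + (bL + bS)) - (b0H + (b0L + b0S))) at heIII
  rw [eL0] at hr1
  change r * (l1 + σ) ≤ l1 at hr1
  -- rewrite the goal in the piece variables
  rw [eA0, eH1, eA1, eH1A1, eB1, eH1B1, eB0, eH1AB, eH0]
  change 0 ≤ (a0H + (a0L + a0S) - a0H) * (bH + (bL + bS) - (bS + bH)) + (aH + (aL + aS) - (aS + aH)) * (b0H + (b0L + b0S) - b0H)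
        + (1 - (1 - l1 - σ)) * (cS + cH) + (1 - (1 - l1)) * c00
        - ((1 - l1) - (1 - l1 - σ)) * (aH + (aL + aS)) * (bH + (bL + bS))
        - (1 - (1 - l1)) * ((aH + (aL + aS)) * (b0H + (b0L + b0S)) + (a0H + (a0L + a0S)) * (bH + (bL + bS)))
        + q * (((1 - l1) - (1 - l1 - σ)) * ((aH + (aL + aS)) - (a0H + (a0L + a0S))) * ((bH + (bL + bS)) - (b0H + (b0L + b0S))))
  -- nonnegativity of the pieces
  have hl1 : 0 ≤ l1 := measureReal_nonneg
  have hσ0 : 0 ≤ σ := measureReal_nonneg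
  have haL0 : 0 ≤ aL := measureReal_nonneg
  have hbL0 : 0 ≤ bL := measureReal_nonneg
  have haLl : aL ≤ l1 := measureReal_mono Set.inter_subset_right
  have hbLl : bL ≤ l1 := measureReal_mono Set.inter_subset_right
  have ha0Ll : a0L ≤ l1 := measureReal_mono Set.inter_subset_right
  have hb0Ll : b0L ≤ l1 := measureReal_mono Set.inter_subset_right
  have hcLl : cL ≤ l1 := measureReal_mono Set.inter_subset_right
  have ha0L0 : 0 ≤ a0L := measureReal_nonneg
  have hb0L0 : 0 ≤ b0L := measureReal_nonneg
  have hcL0 : 0 ≤ cL := measureReal_nonneg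
  -- forget the definitions of the pieces: from here on everything is polynomial bookkeeping
  clear_value cL cS cH c10 c00 b0H b0S b0L bH bS bL a0H a0S a0L aH aS aL σ l1 q
  -- the polynomial identity  ℓ¹ℓ⁰·(M₂ + qσΔAΔB) = ℓ⁰²·s₁₁ + ℓ¹(ℓ¹ − rℓ⁰)·n₁₀ + rℓ¹ℓ⁰·s₀₀ + X̃·U + ℓ¹ℓ⁰·Σ (e_• + qσΔb)·E_•
  have hid := pivotCertificate_slack_identity l1 σ r q aL aS aH a0L a0S a0H bL bS bH b0L b0S b0H cS cH c10 c00
  by_cases hl1pos : 0 < l1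
  · have hl0n : 0 ≤ l1 + σ := add_nonneg hl1 hσ0
    have hpos : 0 < l1 * (l1 + σ) := mul_pos hl1pos (by linarith only [hl1pos, hσ0])
    refine (mul_nonneg_iff_of_pos_left hpos).1 ?_
    rw [hid]
    have t1 : 0 ≤ (l1 + σ) * (l1 + σ) * ((aS + aH) * (bS + bH) + (1 - (1 - l1)) * (cS + cH)
        + (1 - l1) * (aH + (aL + aS)) * (bH + (bL + bS)) - (aS + aH) * (bH + (bL + bS)) - (bS + bH) * (aH + (aL + aS))) :=
      mul_nonneg (mul_nonneg hl0n hl0n) h11'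
    have t2 : 0 ≤ l1 * (l1 - r * (l1 + σ)) * (aH * b0H + (1 - (1 - l1 - σ)) * c10
        + (1 - l1 - σ) * (aH + (aL + aS)) * (b0H + (b0L + b0S)) - aH * (b0H + (b0L + b0S)) - b0H * (aH + (aL + aS))) :=
      mul_nonneg (mul_nonneg hl1 (sub_nonneg.2 hr1)) h10'
    have t3 : 0 ≤ l1 * (l1 + σ) * r * (a0H * b0H + (1 - (1 - l1 - σ)) * c00
        + (1 - l1 - σ) * (a0H + (a0L + a0S)) * (b0H + (b0L + b0S)) - a0H * (b0H + (b0L + b0S)) - b0H * (a0H + (a0L + a0S))) :=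
      mul_nonneg (mul_nonneg (mul_nonneg hl1 hl0n) hr0) h00'
    have t4 : 0 ≤ ((l1 + σ) * bL - l1 * (b0L + b0S)) * (aS * l1 - aL * σ) := mul_nonneg (sub_nonneg.2 hX) (sub_nonneg.2 hUA)
    have t5 : 0 ≤ ((l1 * (bH + (bL + bS)) - bL) - r * ((l1 + σ) * (b0H + (b0L + b0S)) - (b0L + b0S))
        + q * σ * ((bH + (bL + bS)) - (b0H + (b0L + b0S)))) * ((aL + aS) - (a0L + a0S)) :=
      mul_nonneg (by linarith only [heI]) (sub_nonneg.2 hE1)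
    have t6 : 0 ≤ (l1 * (bH + (bL + bS)) - r * ((l1 + σ) * (b0H + (b0L + b0S)))
        + q * σ * ((bH + (bL + bS)) - (b0H + (b0L + b0S)))) * ((aH - c10) - (a0H - c00)) :=
      mul_nonneg (by linarith only [heII]) (sub_nonneg.2 hE2)
    have t7 : 0 ≤ (r * ((l1 + σ) * (1 - (b0H + (b0L + b0S)))) - l1 * (1 - (bH + (bL + bS)))
        + q * σ * ((bH + (bL + bS)) - (b0H + (b0L + b0S)))) * (c10 - c00) :=
      mul_nonneg (by linarith only [heIII]) (sub_nonneg.2 hE3)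
    have t567 : 0 ≤ l1 * (l1 + σ) * (((l1 * (bH + (bL + bS)) - bL) - r * ((l1 + σ) * (b0H + (b0L + b0S)) - (b0L + b0S))
              + q * σ * ((bH + (bL + bS)) - (b0H + (b0L + b0S)))) * ((aL + aS) - (a0L + a0S))
            + (l1 * (bH + (bL + bS)) - r * ((l1 + σ) * (b0H + (b0L + b0S)))
              + q * σ * ((bH + (bL + bS)) - (b0H + (b0L + b0S)))) * ((aH - c10) - (a0H - c00))
            + (r * ((l1 + σ) * (1 - (b0H + (b0L + b0S)))) - l1 * (1 - (bH + (bL + bS)))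
              + q * σ * ((bH + (bL + bS)) - (b0H + (b0L + b0S)))) * (c10 - c00)) :=
      mul_nonneg (mul_nonneg hl1 hl0n) (add_nonneg (add_nonneg t5 t6) t7)
    exact add_nonneg (add_nonneg (add_nonneg (add_nonneg t1 t2) t3) t4) t567
  · -- degenerate lower ball: `ℓ¹ = 0`, all `L1`-pieces vanish and `M₂ + qσΔAΔB ≥ σ·Cov(A1,B1) ≥ 0` by Harris
    have hl1z : l1 = 0 := le_antisymm (not_lt.1 hl1pos) hl1
    have haLz : aL = 0 := le_antisymm (hl1z ▸ haLl) haL0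
    have hbLz : bL = 0 := le_antisymm (hl1z ▸ hbLl) hbL0
    have ha0Lz : a0L = 0 := le_antisymm (hl1z ▸ ha0Ll) ha0L0
    have hb0Lz : b0L = 0 := le_antisymm (hl1z ▸ hb0Ll) hb0L0
    have hcLz : cL = 0 := le_antisymm (hl1z ▸ hcLl) hcL0
    have harris : μ.real A1 * μ.real B1 ≤ μ.real (A1 ∩ B1) :=
      prodBernoulli_harris p hA1u hB1u MeasurableSet.of_discrete MeasurableSet.of_discrete
    rw [eA1, eB1, eAB, haLz, hbLz, hcLz] at harris
    rw [haLz, ha0Lz] at hΔA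
    rw [hbLz, hb0Lz] at hΔB
    rw [hl1z, haLz, hbLz, ha0Lz, hb0Lz]
    have hid0 : (a0H + (0 + a0S) - a0H) * (bH + (0 + bS) - (bS + bH)) + (aH + (0 + aS) - (aS + aH)) * (b0H + (0 + b0S) - b0H)
        + (1 - (1 - 0 - σ)) * (cS + cH) + (1 - (1 - (0:ℝ))) * c00
        - ((1 - 0) - (1 - 0 - σ)) * (aH + (0 + aS)) * (bH + (0 + bS))
        - (1 - (1 - (0:ℝ))) * ((aH + (0 + aS)) * (b0H + (0 + b0S)) + (a0H + (0 + a0S)) * (bH + (0 + bS)))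
        + q * (((1 - 0) - (1 - 0 - σ)) * ((aH + (0 + aS)) - (a0H + (0 + a0S))) * ((bH + (0 + bS)) - (b0H + (0 + b0S))))
        = σ * ((cH + (0 + cS)) - (aH + (0 + aS)) * (bH + (0 + bS)))
          + q * σ * (((aH + (0 + aS)) - (a0H + (0 + a0S))) * ((bH + (0 + bS)) - (b0H + (0 + b0S)))) := by ring
    rw [hid0]
    exact add_nonneg (mul_nonneg hσ0 (by linarith only [harris])) (mul_nonneg (mul_nonneg hq0 hσ0) (mul_nonneg (sub_nonneg.2 hΔA) (sub_nonneg.2 hΔB)))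

end SahiOneStep

end Summit.CriticalPhenomena.PercolationContinuityZ3.Theorems
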